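import Mathlib
import HarnessLib
import Literature.RingTheory.Valuation.RootReduction
import Literature.NumberTheory.DiophantineGeometry.BelyiPairWronskian

/-!
# Reduction of a Belyi pair at the Gauss point: the derivative trick and the counting rules

(Layer 2b of the bad-prime floor for the Belyi degree.)  Let `K` be an algebraically closed field of
characteristic `0`, `A` a valuation subring of `K` with residue field `κ`, and `(p, q)` a Belyi pair of
degree `d` (`IsBelyiPair d p q`) that is *tame* for `A`: `1, …, d` are units of `A`.  Write
`n_f = #intRoots A f` for the number of roots of `f` in the closed unit disc and `N` for the number of
DISTINCT roots of `p q (p - q)` in it.  This file proves the local counting rules at the Gauss point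
of the unit disc (all transported to an arbitrary closed disc `D(s, v c)` by `IsBelyiPair.comp`):

* `card_intRoots_wronskian` — **the derivative trick**: for `P, Q ≠ 0` with `n_P ≠ n_Q` in `κ`,
  `n_{PQ' - P'Q} = n_P + n_Q - 1` (reduce primitive models: the Wronskian of the monic reductions has
  leading coefficient `n_Q - n_P`);
* `IsBelyiPair.card_special_eq_of_ne` and its companions — **the weak rules**:
  `n_p ≠ n_q ⇒ N = n_{p-q} + 1`, `n_{p-q} ≠ n_q ⇒ N = n_p + 1`, `n_p ≠ n_{p-q} ⇒ N = n_q + 1`, and for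
  every `λ`, `n_{p - λq} ≠ n_q ⇒ N + n_{p - λq} = n_p + n_{p-q} + 1` (derivative trick + the root count
  of the Wronskian of a Belyi pair);
* `IsBelyiPair.count_redRoots_sub_C_mul_le_one` — **special-free residue classes are unramified**:
  a residue class containing no root of `p q (p - q)` contains at most one root of `p - λ q`, for every
  `λ ∈ K`;
* `exists_optimal_centre` — **the optimal centre**: with `n = n_q` and `a = p_n / q_n`,
  `gaussVal (p - a q) ≤ gaussVal (p - a' q)` for all `a'`, and the reduction of `(p - a q)/q` is
  non-constant: `redPoly (p - a q) ≠ redPoly q`;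
* `card_roots_add_card_roots_eq_one` — **two-point Riemann–Hurwitz over `κ`**: for coprime
  `P₁, Q₁ ∈ κ[X]` of different degrees `≤ d`, if every point outside the zeros of `P₁ Q₁` is
  unramified for `P₁/Q₁` then `#Z(P₁) + #Z(Q₁) = 1`.

All statements are folklore (non-archimedean function theory on discs; cf. Zannier, *Good
reduction of certain covers `ℙ¹ → ℙ¹`*, Israel J. Math. 124 (2001), and the Newton-polygon
dictionary of `RootReduction`); everything is proved, no named facts.
-/

noncomputable section

namespace Literature.NumberTheory.DiophantineGeometry

open Polynomial IsLocalRing Literature.RingTheory.Valuation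
open scoped Classical

section General

variable {K : Type*} [Field K] (A : ValuationSubring K)

/-- The Gauss value is ultrametric. [folklore] -/
theorem gaussVal_add_le (f g : K[X]) : gaussVal A (f + g) ≤ max (gaussVal A f) (gaussVal A g) :=
  gaussVal_le A fun i => by
    rw [coeff_add]
    exact (A.valuation.map_add _ _).trans
      (max_le_max (valuation_coeff_le_gaussVal A f i) (valuation_coeff_le_gaussVal A g i))

/-- The Gauss value of `-f`. [folklore] -/
theorem gaussVal_neg (f : K[X]) : gaussVal A (-f) = gaussVal A f := by
  apply le_antisymm
  · exact gaussVal_le A fun i => by rw [coeff_neg, Valuation.map_neg]; exact valuation_coeff_le_gaussVal A f i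
  · exact gaussVal_le A fun i => by
      rw [← Valuation.map_neg, ← coeff_neg]; exact valuation_coeff_le_gaussVal A (-f) i

/-- The Gauss value is ultrametric (difference form). [folklore] -/
theorem gaussVal_sub_le (f g : K[X]) : gaussVal A (f - g) ≤ max (gaussVal A f) (gaussVal A g) := by
  rw [sub_eq_add_neg, ← gaussVal_neg A g]; exact gaussVal_add_le A f (-g)

/-- A polynomial over `A` has Gauss value `< 1` iff its reduction vanishes. [folklore] -/
theorem gaussVal_map_lt_one_iff (g : A[X]) : gaussVal A (g.map (algebraMap A K)) < 1 ↔
    g.map (residue A) = 0 := by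
  constructor
  · intro h
    ext i
    rw [coeff_map, coeff_zero, residue_eq_zero_iff, A.valuation_lt_one_iff]
    have := valuation_coeff_le_gaussVal A (g.map (algebraMap A K)) i
    rw [coeff_map, ValuationSubring.algebraMap_apply] at this
    exact lt_of_le_of_lt this h
  · intro h
    by_cases h0 : g.map (algebraMap A K) = 0
    · rw [h0, gaussVal_zero]; exact zero_lt_one
    obtain ⟨i, hi⟩ := exists_valuation_coeff_eq_gaussVal A h0
    rw [← hi, coeff_map, ValuationSubring.algebraMap_apply, ← A.valuation_lt_one_iff,
      ← residue_eq_zero_iff, ← coeff_map, h, coeff_zero]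

variable {A}

/-- **Primitive models are unique up to units.**  If `g ∈ A[X]` has non-zero reduction and
`g = c' f` over `K`, then the reduction of `g` is a non-zero constant multiple of `redPoly A f`.
[folklore] -/
theorem exists_map_residue_eq_C_mul_redPoly [Nontrivial (ResidueField A)] {f : K[X]} (hs : f.Splits)
    {c' : K} {g : A[X]} (hgf : g.map (algebraMap A K) = C c' * f) (hg : g.map (residue A) ≠ 0) :
    ∃ u : ResidueField A, u ≠ 0 ∧ g.map (residue A) = C u * redPoly A f := by
  have hf : f ≠ 0 := by
    rintro rfl
    rw [mul_zero, Polynomial.map_eq_zero_iff (IsFractionRing.injective A K)] at hgf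
    rw [hgf, Polynomial.map_zero] at hg
    exact hg rfl
  obtain ⟨c, hc, g₀, hg₀f, hg₀r⟩ := exists_model A hf hs
  have h1 : A.valuation c * gaussVal A f = 1 := valuation_mul_gaussVal_eq_one hg₀f hg₀r
  have h2 : A.valuation c' * gaussVal A f = 1 := by
    rw [← gaussVal_C_mul, ← hgf]; exact gaussVal_map_eq_one A hg
  have hcc : A.valuation c' = A.valuation c := by
    have hgv : gaussVal A f ≠ 0 := gaussVal_ne_zero A hf
    exact mul_right_cancel₀ hgv (h2.trans h1.symm)
  obtain ⟨u, hu⟩ := (A.valuation_eq_iff _ _).mp hcc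
  -- `g = u • g₀`
  have hg_eq : g = C (u : A) * g₀ := by
    apply Polynomial.map_injective _ (IsFractionRing.injective A K)
    rw [Polynomial.map_mul, map_C, hgf, hg₀f, ← mul_assoc, ← C_mul, ValuationSubring.algebraMap_apply,
      hu]
  refine ⟨residue A (u : A), ?_, ?_⟩
  · rw [residue_ne_zero_iff_isUnit]; exact Units.isUnit u
  · rw [hg_eq, Polynomial.map_mul, map_C, hg₀r]

/-- Consequently the reduction of any primitive model of `f` has degree `#intRoots A f` … [folklore] -/
theorem natDegree_map_residue_eq_card_intRoots [Nontrivial (ResidueField A)] {f : K[X]} (hs : f.Splits)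
    {c' : K} {g : A[X]} (hgf : g.map (algebraMap A K) = C c' * f) (hg : g.map (residue A) ≠ 0) :
    (g.map (residue A)).natDegree = Multiset.card (intRoots A f) := by
  obtain ⟨u, hu, h⟩ := exists_map_residue_eq_C_mul_redPoly hs hgf hg
  rw [h, natDegree_C_mul hu, natDegree_redPoly]

/-- … and the same roots as `redPoly A f`. [folklore] -/
theorem roots_map_residue_eq_redRoots [Nontrivial (ResidueField A)] {f : K[X]} (hs : f.Splits)
    {c' : K} {g : A[X]} (hgf : g.map (algebraMap A K) = C c' * f) (hg : g.map (residue A) ≠ 0) :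
    (g.map (residue A)).roots = redRoots A f := by
  obtain ⟨u, hu, h⟩ := exists_map_residue_eq_C_mul_redPoly hs hgf hg
  rw [h, roots_C_mul _ hu, roots_redPoly]

end General

/-! ### Wronskians: scalars, maps, leading coefficient of the Wronskian of two monics -/

section WronskianAlgebra

variable {R S : Type*} [CommRing R] [CommRing S]

/-- `W(c a, b) = c W(a, b)`. [folklore] -/
theorem wronskian_C_mul_left (c : R) (a b : R[X]) : wronskian (C c * a) b = C c * wronskian a b := by
  simp only [wronskian, derivative_mul, derivative_C, zero_mul, zero_add]; ring

/-- `W(a, c b) = c W(a, b)`. [folklore] -/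
theorem wronskian_C_mul_right (c : R) (a b : R[X]) : wronskian a (C c * b) = C c * wronskian a b := by
  simp only [wronskian, derivative_mul, derivative_C, zero_mul, zero_add]; ring

/-- The Wronskian commutes with ring homomorphisms. [folklore] -/
theorem wronskian_map (f : R →+* S) (a b : R[X]) :
    (wronskian a b).map f = wronskian (a.map f) (b.map f) := by
  simp only [wronskian, Polynomial.map_sub, Polynomial.map_mul, derivative_map]

/-- `W(p - c q, q) = W(p, q)`. [folklore] -/
theorem wronskian_sub_C_mul_left (p q : R[X]) (c : R) : wronskian (p - C c * q) q = wronskian p q := by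
  rw [sub_eq_add_neg, wronskian_add_left, wronskian_neg_left, wronskian_C_mul_left,
    wronskian_self_eq_zero, mul_zero, neg_zero, add_zero]

/-- Chain rule for the Wronskian under an affine substitution `L = s + cX`:
`W(p ∘ L, q ∘ L) = c · W(p, q) ∘ L`. [folklore] -/
theorem wronskian_comp_C_add_C_mul_X (p q : R[X]) (s c : R) :
    wronskian (p.comp (C s + C c * X)) (q.comp (C s + C c * X)) =
      C c * (wronskian p q).comp (C s + C c * X) := by
  have hL : derivative (C s + C c * X) = C c := by
    rw [derivative_add, derivative_C, derivative_C_mul_X, zero_add]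
  simp only [wronskian, derivative_comp, hL, sub_comp, mul_comp]
  ring

/-- The degree of a Wronskian is at most `deg a + deg b - 1`. [folklore] -/
theorem natDegree_wronskian_le (a b : R[X]) :
    (wronskian a b).natDegree ≤ a.natDegree + b.natDegree - 1 := by
  unfold wronskian
  refine (natDegree_sub_le _ _).trans (max_le ?_ ?_)
  · by_cases hb : b.natDegree = 0
    · obtain ⟨x, rfl⟩ := natDegree_eq_zero.mp hb
      rw [derivative_C, mul_zero, natDegree_zero]; exact Nat.zero_le _
    · refine natDegree_mul_le.trans ?_
      have := natDegree_derivative_le b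
      omega
  · by_cases ha : a.natDegree = 0
    · obtain ⟨x, rfl⟩ := natDegree_eq_zero.mp ha
      rw [derivative_C, zero_mul, natDegree_zero]; exact Nat.zero_le _
    · refine natDegree_mul_le.trans ?_
      have := natDegree_derivative_le a
      omega

/-- For `b` of degree `n`: the coefficient of `b'` in degree `n - 1` is `n · lc(b)`. [folklore] -/
theorem coeff_derivative_natDegree_sub_one (b : R[X]) :
    (derivative b).coeff (b.natDegree - 1) = b.natDegree * b.leadingCoeff := by
  by_cases hn : b.natDegree = 0
  · rw [hn, Nat.cast_zero, zero_mul]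
    obtain ⟨x, hx⟩ := natDegree_eq_zero.mp hn
    rw [← hx, derivative_C, coeff_zero]
  · rw [coeff_derivative]
    have : b.natDegree - 1 + 1 = b.natDegree := Nat.succ_pred_eq_of_ne_zero hn
    rw [this, ← leadingCoeff, mul_comm]
    push_cast [Nat.cast_sub (Nat.one_le_iff_ne_zero.mpr hn)]
    ring

/-- **Leading coefficient of a Wronskian.**  For `a, b` of degrees `m, n` with `m + n ≥ 1`, the
coefficient of `W(a, b) = a b' - a' b` in degree `m + n - 1` is `(n - m) · lc(a) · lc(b)`. [folklore] -/
theorem coeff_wronskian_natDegree (a b : R[X]) (hmn : 1 ≤ a.natDegree + b.natDegree) :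
    (wronskian a b).coeff (a.natDegree + b.natDegree - 1) =
      ((b.natDegree : R) - a.natDegree) * a.leadingCoeff * b.leadingCoeff := by
  have key : ∀ a b : R[X], 1 ≤ a.natDegree + b.natDegree →
      (a * derivative b).coeff (a.natDegree + b.natDegree - 1) =
        b.natDegree * a.leadingCoeff * b.leadingCoeff := by
    intro a b hmn
    by_cases hn : b.natDegree = 0
    · obtain ⟨x, hx⟩ := natDegree_eq_zero.mp hn
      rw [hn, ← hx, derivative_C, mul_zero, coeff_zero, Nat.cast_zero, zero_mul, zero_mul]
    · have : a.natDegree + b.natDegree - 1 = a.natDegree + (b.natDegree - 1) := by omega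
      rw [this, coeff_mul_add_eq_of_natDegree_le le_rfl (natDegree_derivative_le b), ← leadingCoeff,
        coeff_derivative_natDegree_sub_one]
      ring
  unfold wronskian
  rw [coeff_sub, key a b hmn, mul_comm (derivative a) b, add_comm a.natDegree,
    key b a (by omega)]
  ring

/-- For monic `a, b` of degrees `m, n` with `m + n ≥ 1`, the coefficient of `W(a, b)` in degree
`m + n - 1` is `n - m`. [folklore] -/
theorem coeff_wronskian_of_monic {a b : R[X]} (ha : a.Monic) (hb : b.Monic)
    (hmn : 1 ≤ a.natDegree + b.natDegree) :
    (wronskian a b).coeff (a.natDegree + b.natDegree - 1) = (b.natDegree : R) - a.natDegree := by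
  rw [coeff_wronskian_natDegree a b hmn, ha.leadingCoeff, hb.leadingCoeff, mul_one, mul_one]

end WronskianAlgebra

/-! ### The derivative trick -/

section DerivativeTrick

variable {K : Type*} [Field K] [IsAlgClosed K] (A : ValuationSubring K)

/-- **The derivative trick.**  Let `P, Q ∈ K[X]` be non-zero with `n_P ≠ n_Q` in the residue field,
where `n_f = #intRoots A f` is the number of roots of `f` in the closed unit disc.  Then the Wronskian
`P Q' - P' Q` has exactly `n_P + n_Q - 1` roots in the closed unit disc.  (Reduce primitive models:
the Wronskian of the monic reductions has degree exactly `n_P + n_Q - 1`.) [folklore] -/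
theorem card_intRoots_wronskian {P Q : K[X]} (hP : P ≠ 0) (hQ : Q ≠ 0)
    (hne : (Multiset.card (intRoots A P) : ResidueField A) ≠ Multiset.card (intRoots A Q)) :
    Multiset.card (intRoots A (wronskian P Q)) =
      Multiset.card (intRoots A P) + Multiset.card (intRoots A Q) - 1 := by
  obtain ⟨cP, hcP, gP, hgPf, hgPr⟩ := exists_model A hP (IsAlgClosed.splits P)
  obtain ⟨cQ, hcQ, gQ, hgQf, hgQr⟩ := exists_model A hQ (IsAlgClosed.splits Q)
  set W₀ : A[X] := wronskian gP gQ with hW₀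
  have hWf : W₀.map (algebraMap A K) = C (cP * cQ) * wronskian P Q := by
    rw [hW₀, wronskian_map, hgPf, hgQf, wronskian_C_mul_left, wronskian_C_mul_right, ← mul_assoc,
      ← C_mul]
  have hWr : W₀.map (residue A) = wronskian (redPoly A P) (redPoly A Q) := by
    rw [hW₀, wronskian_map, hgPr, hgQr]
  -- the reduced Wronskian has degree exactly `n_P + n_Q - 1`
  set nP := Multiset.card (intRoots A P) with hnP
  set nQ := Multiset.card (intRoots A Q) with hnQ
  have hdP : (redPoly A P).natDegree = nP := natDegree_redPoly A P
  have hdQ : (redPoly A Q).natDegree = nQ := natDegree_redPoly A Q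
  have h1 : 1 ≤ nP + nQ := by
    by_contra h
    have hp0 : nP = 0 := by omega
    have hq0 : nQ = 0 := by omega
    rw [hp0, hq0] at hne
    exact hne rfl
  have hcoeff : (wronskian (redPoly A P) (redPoly A Q)).coeff (nP + nQ - 1) = (nQ : ResidueField A) - nP := by
    have h := coeff_wronskian_of_monic (monic_redPoly A P) (monic_redPoly A Q) (by rw [hdP, hdQ]; exact h1)
    rwa [hdP, hdQ] at h
  have hcoeff_ne : (wronskian (redPoly A P) (redPoly A Q)).coeff (nP + nQ - 1) ≠ 0 := by
    rw [hcoeff, sub_ne_zero]; exact hne.symm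
  have hWr0 : W₀.map (residue A) ≠ 0 := by
    rw [hWr]; intro h; rw [h, coeff_zero] at hcoeff_ne; exact hcoeff_ne rfl
  have hdegW : (W₀.map (residue A)).natDegree = nP + nQ - 1 := by
    rw [hWr]
    apply le_antisymm
    · have := natDegree_wronskian_le (redPoly A P) (redPoly A Q)
      rwa [hdP, hdQ] at this
    · exact le_natDegree_of_ne_zero hcoeff_ne
  -- compare with the number of integral roots of `W(P, Q)`
  have hW0 : wronskian P Q ≠ 0 := by
    intro h
    rw [h, mul_zero, Polynomial.map_eq_zero_iff (IsFractionRing.injective A K)] at hWf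
    rw [hWf, Polynomial.map_zero] at hWr0
    exact hWr0 rfl
  rw [← hdegW]
  exact (natDegree_map_residue_eq_card_intRoots (IsAlgClosed.splits _) hWf hWr0).symm

end DerivativeTrick

/-! ### The weak counting rules for a Belyi pair -/

section Rules

variable {K : Type*} [Field K] [IsAlgClosed K] [CharZero K] (A : ValuationSubring K)
variable {d : ℕ} {p q : K[X]}

omit [IsAlgClosed K] [CharZero K] in
/-- Tameness converts an inequality of naturals `≤ d` into one in the residue field. [folklore] -/
theorem natCast_ne_natCast_of_tame
    (htame : ∀ m : ℕ, 0 < m → m ≤ d → (m : ResidueField A) ≠ 0) {a b : ℕ} (ha : a ≤ d) (hb : b ≤ d)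
    (hab : a ≠ b) : (a : ResidueField A) ≠ b := by
  wlog hlt : a < b generalizing a b
  · exact (this hb ha hab.symm (lt_of_le_of_ne (not_lt.mp hlt) hab.symm)).symm
  intro h
  apply htame (b - a) (Nat.sub_pos_of_lt hlt) (by omega)
  rw [Nat.cast_sub hlt.le, sub_eq_zero]
  exact h.symm

omit [IsAlgClosed K] [CharZero K] in
/-- The total count of roots of `p q (p - q)` in the closed unit disc is `n_p + n_q + n_{p-q}`.
[folklore] -/
theorem IsBelyiPair.card_filter_roots_prod_mem (h : IsBelyiPair d p q) :
    Multiset.card ((p * q * (p - q)).roots.filter (· ∈ A)) =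
      Multiset.card (intRoots A p) + Multiset.card (intRoots A q) + Multiset.card (intRoots A (p - q)) := by
  rw [h.roots_prod, Multiset.filter_add, Multiset.filter_add, Multiset.card_add, Multiset.card_add,
    card_intRoots, card_intRoots, card_intRoots]

/-- The root count of the Wronskian of a Belyi pair in the closed unit disc:
`n_W + N = n_p + n_q + n_{p-q}`, `N` the number of distinct special points in the disc. [folklore] -/
theorem IsBelyiPair.card_intRoots_wronskian_add (h : IsBelyiPair d p q) :
    Multiset.card (intRoots A (wronskian p q)) + ((p * q * (p - q)).roots.toFinset.filter (· ∈ A)).card =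
      Multiset.card (intRoots A p) + Multiset.card (intRoots A q) + Multiset.card (intRoots A (p - q)) := by
  rw [card_intRoots, h.card_roots_wronskian_filter (· ∈ A), h.card_filter_roots_prod_mem]

/-- **Weak rule (λ-form).**  If `n_{p - λ q} ≠ n_q` in the residue field then
`N + n_{p - λq} = n_p + n_{p-q} + 1`. [folklore] -/
theorem IsBelyiPair.card_special_add_of_ne (h : IsBelyiPair d p q) (lam : K)
    (hne : (Multiset.card (intRoots A (p - C lam * q)) : ResidueField A) ≠ Multiset.card (intRoots A q)) :
    ((p * q * (p - q)).roots.toFinset.filter (· ∈ A)).card + Multiset.card (intRoots A (p - C lam * q)) =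
      Multiset.card (intRoots A p) + Multiset.card (intRoots A (p - q)) + 1 := by
  have hP : p - C lam * q ≠ 0 := by
    intro hz
    have hcop := h.isCoprime
    rw [sub_eq_zero] at hz
    -- `p = λ q` contradicts coprimality and `d ≥ 1`
    have hq1 : IsUnit q := by
      apply isCoprime_self.mp
      have : IsCoprime (C lam * q) q := hz ▸ hcop
      exact this.of_mul_left_right
    have hqdeg : q.natDegree = 0 := natDegree_eq_zero_of_isUnit hq1
    have hpdeg : p.natDegree = 0 := by
      have : p.natDegree ≤ 0 := by rw [hz]; exact (natDegree_C_mul_le lam q).trans hqdeg.le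
      omega
    have := h.natDegree_eq
    rw [hpdeg, hqdeg, max_self] at this
    exact h.pos.ne' this.symm
  have htrick := card_intRoots_wronskian A hP h.right_ne_zero hne
  rw [wronskian_sub_C_mul_left] at htrick
  have hsum := h.card_intRoots_wronskian_add A
  have h1 : 1 ≤ Multiset.card (intRoots A (p - C lam * q)) + Multiset.card (intRoots A q) := by
    by_contra h0
    apply hne
    have ha : Multiset.card (intRoots A (p - C lam * q)) = 0 := by omega
    have hb : Multiset.card (intRoots A q) = 0 := by omega
    rw [ha, hb]
  omega

/-- **Weak rule 0/∞.**  If `n_p ≠ n_q` in the residue field then `N = n_{p-q} + 1`. [folklore] -/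
theorem IsBelyiPair.card_special_eq_of_ne (h : IsBelyiPair d p q)
    (hne : (Multiset.card (intRoots A p) : ResidueField A) ≠ Multiset.card (intRoots A q)) :
    ((p * q * (p - q)).roots.toFinset.filter (· ∈ A)).card = Multiset.card (intRoots A (p - q)) + 1 := by
  have h0 := h.card_special_add_of_ne A 0 (by rwa [C_0, zero_mul, sub_zero])
  rw [C_0, zero_mul, sub_zero] at h0
  omega

/-- **Weak rule 1/∞.**  If `n_{p-q} ≠ n_q` in the residue field then `N = n_p + 1`. [folklore] -/
theorem IsBelyiPair.card_special_eq_of_sub_ne (h : IsBelyiPair d p q)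
    (hne : (Multiset.card (intRoots A (p - q)) : ResidueField A) ≠ Multiset.card (intRoots A q)) :
    ((p * q * (p - q)).roots.toFinset.filter (· ∈ A)).card = Multiset.card (intRoots A p) + 1 := by
  have h1 := h.card_special_add_of_ne A 1 (by rwa [C_1, one_mul])
  rw [C_1, one_mul] at h1
  omega

/-- **Weak rule 0/1.**  If `n_p ≠ n_{p-q}` in the residue field then `N = n_q + 1`. [folklore] -/
theorem IsBelyiPair.card_special_eq_of_ne_sub (h : IsBelyiPair d p q)
    (hne : (Multiset.card (intRoots A p) : ResidueField A) ≠ Multiset.card (intRoots A (p - q))) :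
    ((p * q * (p - q)).roots.toFinset.filter (· ∈ A)).card = Multiset.card (intRoots A q) + 1 := by
  -- apply the `0/∞` rule to the pair `(p, p - q)`, whose "`p - q`" is `q`
  have h' : IsBelyiPair d p (p - q) := by simpa using h.swap.oneSub.swap
  have := h'.card_special_eq_of_ne A hne
  have hprod : (p * (p - q) * (p - (p - q))).roots = (p * q * (p - q)).roots := by
    rw [sub_sub_cancel]; congr 1; ring
  rwa [hprod, sub_sub_cancel] at this

end Rules

/-! ### Special-free residue classes are unramified -/

section Unramified

variable {K : Type*} [Field K] [IsAlgClosed K] [CharZero K] (A : ValuationSubring K)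
variable {d : ℕ} {p q : K[X]}

omit [IsAlgClosed K] [CharZero K] in
/-- Two elements of `A` with the same residue differ by an element of valuation `< 1`. [folklore] -/
theorem valuation_sub_lt_one_of_residue_eq {x y : K} (hx : x ∈ A) (hy : y ∈ A)
    (h : residue A ⟨x, hx⟩ = residue A ⟨y, hy⟩) : A.valuation (x - y) < 1 := by
  rw [← sub_eq_zero, ← map_sub, residue_eq_zero_iff, A.valuation_lt_one_iff] at h
  exact h

omit [IsAlgClosed K] [CharZero K] in
/-- A point at valuation-distance `< 1` from `y ∈ A` lies in `A` and has the same residue.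
[folklore] -/
theorem mem_and_residue_eq_of_valuation_sub_lt_one {x y : K} (hy : y ∈ A)
    (h : A.valuation (x - y) < 1) : ∃ hx : x ∈ A, residue A ⟨x, hx⟩ = residue A ⟨y, hy⟩ := by
  have hxy : x - y ∈ A := (A.valuation_le_one_iff _).mp h.le
  have hx : x ∈ A := by
    have : x = (x - y) + y := by ring
    rw [this]; exact A.add_mem _ _ hxy hy
  refine ⟨hx, ?_⟩
  rw [← sub_eq_zero, ← map_sub, residue_eq_zero_iff, A.valuation_lt_one_iff]
  exact h

/-- If `p - λ q` has a root of multiplicity `≥ 2`, that root is a special point (a root of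
`p q (p - q)`): it is a root of the Wronskian. [folklore] -/
theorem IsBelyiPair.mem_roots_of_two_le_rootMultiplicity (h : IsBelyiPair d p q) {lam t : K}
    (ht : 2 ≤ (p - C lam * q).rootMultiplicity t) : t ∈ (p * q * (p - q)).roots := by
  have hdvd := pow_rootMultiplicity_sub_one_dvd_wronskian (p - C lam * q) q t
  rw [wronskian_sub_C_mul_left] at hdvd
  have h1 : (X - C t) ∣ wronskian p q :=
    (dvd_pow_self (X - C t) (by omega : (p - C lam * q).rootMultiplicity t - 1 ≠ 0)).trans hdvd
  have hroot : (wronskian p q).IsRoot t := by rwa [← dvd_iff_isRoot]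
  have hpos : 0 < (wronskian p q).rootMultiplicity t :=
    (rootMultiplicity_pos h.wronskian_ne_zero).mpr hroot
  rw [h.rootMultiplicity_wronskian] at hpos
  have : 0 < (p * q * (p - q)).rootMultiplicity t := by omega
  exact (mem_roots h.prod_ne_zero).mpr ((rootMultiplicity_pos h.prod_ne_zero).mp this)

omit [IsAlgClosed K] [CharZero K] in
/-- `p - λ q ≠ 0` for a Belyi pair. [folklore] -/
theorem IsBelyiPair.sub_C_mul_ne_zero (h : IsBelyiPair d p q) (lam : K) : p - C lam * q ≠ 0 := by
  intro hz
  rw [sub_eq_zero] at hz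
  have hq1 : IsUnit q := by
    apply isCoprime_self.mp
    have : IsCoprime (C lam * q) q := hz ▸ h.isCoprime
    exact this.of_mul_left_right
  have hqdeg : q.natDegree = 0 := natDegree_eq_zero_of_isUnit hq1
  have hpdeg : p.natDegree = 0 := by
    have : p.natDegree ≤ 0 := by rw [hz]; exact (natDegree_C_mul_le lam q).trans hqdeg.le
    omega
  have := h.natDegree_eq
  rw [hpdeg, hqdeg, max_self] at this
  exact h.pos.ne' this.symm

omit [IsAlgClosed K] [CharZero K] in
/-- `deg (p - λ q) ≤ d`. [folklore] -/
theorem IsBelyiPair.natDegree_sub_C_mul_le (h : IsBelyiPair d p q) (lam : K) :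
    (p - C lam * q).natDegree ≤ d :=
  (Polynomial.natDegree_sub_le _ _).trans (max_le h.natDegree_left_le
    ((natDegree_C_mul_le _ _).trans h.natDegree_right_le))

omit [IsAlgClosed K] [CharZero K] in
/-- Two distinct roots in a disc give a root count `≥ 2` there. [folklore] -/
theorem two_le_card_filter_roots {f : K[X]} (hf : f ≠ 0) {x y : K} (hxy : x ≠ y) (hx : f.IsRoot x)
    (hy : f.IsRoot y) (P : K → Prop) (hPx : P x) (hPy : P y) :
    2 ≤ Multiset.card (f.roots.filter P) := by
  have hsub : ({x, y} : Multiset K) ≤ f.roots.filter P := by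
    rw [Multiset.le_iff_count]
    intro a
    rw [Multiset.insert_eq_cons, Multiset.count_cons, Multiset.count_singleton]
    by_cases hax : a = x
    · subst hax
      rw [if_neg hxy, zero_add, Multiset.count_filter_of_pos hPx, count_roots, if_pos rfl]
      exact (rootMultiplicity_pos hf).mpr hx
    · rw [if_neg hax, add_zero]
      by_cases hay : a = y
      · subst hay
        rw [if_pos rfl, Multiset.count_filter_of_pos hPy, count_roots]
        exact (rootMultiplicity_pos hf).mpr hy
      · rw [if_neg hay]; exact Nat.zero_le _
  have := Multiset.card_le_card hsub
  rw [Multiset.insert_eq_cons, Multiset.card_cons, Multiset.card_singleton] at this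
  exact this

/-- **Special-free residue classes are unramified.**  Let `(p, q)` be a Belyi pair of degree `d`,
tame for `A`, and let `ā` be a residue class containing no special point (no root of `p q (p - q)`).
Then for every `λ ∈ K` the class `ā` contains at most one root of `p - λ q`, counted with
multiplicity.  (A multiple root would be special; two distinct roots `τ₁, τ₂` would sit in the
special-free closed disc `D(τ₁, v(τ₂ - τ₁))`, where the derivative trick gives the Wronskian
`#roots - 1 ≥ 1` roots — but its roots are special.) [folklore] -/
theorem IsBelyiPair.count_redRoots_sub_C_mul_le_one (h : IsBelyiPair d p q)
    (htame : ∀ m : ℕ, 0 < m → m ≤ d → (m : ResidueField A) ≠ 0) {a : ResidueField A}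
    (hfree : ∀ s ∈ (p * q * (p - q)).roots, ∀ hs : s ∈ A, residue A ⟨s, hs⟩ ≠ a) (lam : K) :
    (redRoots A (p - C lam * q)).count a ≤ 1 := by
  set P := p - C lam * q with hP
  have hP0 : P ≠ 0 := h.sub_C_mul_ne_zero lam
  by_contra hgt
  rw [not_le] at hgt
  -- two roots (with multiplicity) of `P` in the class `a`
  rw [count_redRoots] at hgt
  set M := (intRoots A P).filter fun b => residue A b = a with hM
  obtain ⟨t₁, ht₁⟩ : ∃ t, t ∈ M := Multiset.card_pos_iff_exists_mem.mp (by omega)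
  obtain ⟨M', hM'⟩ := Multiset.exists_cons_of_mem ht₁
  have hcard' : 0 < Multiset.card M' := by
    have := congrArg Multiset.card hM'
    rw [Multiset.card_cons] at this; omega
  obtain ⟨t₂, ht₂'⟩ := Multiset.card_pos_iff_exists_mem.mp hcard'
  have ht₂ : t₂ ∈ M := by rw [hM']; exact Multiset.mem_cons_of_mem ht₂'
  have hmemM : ∀ {t : A}, t ∈ M → (t : K) ∈ P.roots ∧ residue A t = a := fun ht => by
    rw [hM, Multiset.mem_filter, mem_intRoots] at ht; exact ht
  have hroot₁ : P.IsRoot t₁ := (mem_roots hP0).mp (hmemM ht₁).1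
  have hroot₂ : P.IsRoot t₂ := (mem_roots hP0).mp (hmemM ht₂).1
  by_cases heq : t₁ = t₂
  · -- a double root: it is special, contradiction
    subst heq
    have hcount : 2 ≤ M.count t₁ := by
      rw [hM', Multiset.count_cons_self]
      have := Multiset.one_le_count_iff_mem.mpr ht₂'
      omega
    have hmult : 2 ≤ P.rootMultiplicity (t₁ : K) := by
      rw [← count_roots, ← count_intRoots A P t₁]
      exact hcount.trans (Multiset.count_le_of_le _ (Multiset.filter_le _ _))
    exact hfree _ (h.mem_roots_of_two_le_rootMultiplicity hmult) t₁.2 (hmemM ht₁).2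
  · -- two distinct roots: zoom to the disc `D(t₁, v(t₂ - t₁))`
    have hne : (t₁ : K) ≠ t₂ := fun h' => heq (Subtype.ext h')
    set c : K := (t₂ : K) - t₁ with hc
    have hc0 : c ≠ 0 := _root_.sub_ne_zero.mpr (Ne.symm hne)
    have hvc : A.valuation c < 1 :=
      valuation_sub_lt_one_of_residue_eq A t₂.2 t₁.2 (by
        rw [Subtype.coe_eta, Subtype.coe_eta, (hmemM ht₂).2, (hmemM ht₁).2])
    -- no special point lies in the disc
    have hdisc : ∀ x : K, A.valuation (x - t₁) ≤ A.valuation c → ∃ hx : x ∈ A,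
        residue A ⟨x, hx⟩ = a := fun x hx => by
      obtain ⟨hx', hres⟩ := mem_and_residue_eq_of_valuation_sub_lt_one A t₁.2 (lt_of_le_of_lt hx hvc)
      exact ⟨hx', hres.trans (by rw [Subtype.coe_eta]; exact (hmemM ht₁).2)⟩
    have hnoS : ∀ x ∈ (p * q * (p - q)).roots, ¬ A.valuation (x - t₁) ≤ A.valuation c := by
      intro x hx hle
      obtain ⟨hxA, hres⟩ := hdisc x hle
      exact hfree x hx hxA hres
    -- the rescaled pair
    have h' := h.comp (t₁ : K) hc0
    set L : K[X] := C (t₁ : K) + C c * X with hL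
    -- counts in the disc
    have hnP : 2 ≤ Multiset.card (intRoots A (P.comp L)) := by
      rw [hL, card_intRoots_comp P _ hc0]
      refine two_le_card_filter_roots hP0 hne hroot₁ hroot₂ _ ?_ ?_
      · simp
      · rw [hc]
    have hnPle : Multiset.card (intRoots A (P.comp L)) ≤ d := by
      refine (card_intRoots_le_natDegree A _).trans ?_
      have hLdeg : L.natDegree = 1 := by
        rw [hL, add_comm, natDegree_add_C, natDegree_C_mul_X c hc0]
      rw [natDegree_comp, hLdeg, mul_one]
      exact h.natDegree_sub_C_mul_le lam
    have hnq : Multiset.card (intRoots A (q.comp L)) = 0 := by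
      rw [hL, card_intRoots_comp q _ hc0, Multiset.card_eq_zero, Multiset.filter_eq_nil]
      intro x hx
      refine hnoS x ?_
      rw [h.roots_prod]
      exact Multiset.mem_add.mpr (Or.inl (Multiset.mem_add.mpr (Or.inr hx)))
    have hnW : Multiset.card (intRoots A (wronskian (P.comp L) (q.comp L))) = 0 := by
      have hPL : P.comp L = p.comp L - C lam * q.comp L := by
        rw [hP, sub_comp, mul_comp, C_comp]
      rw [hPL, wronskian_sub_C_mul_left, hL, wronskian_comp_C_add_C_mul_X, card_intRoots,
        roots_C_mul _ hc0, Multiset.card_eq_zero, Multiset.filter_eq_nil]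
      intro x hx hxA
      rw [roots_comp_C_add_C_mul_X _ _ hc0] at hx
      obtain ⟨y, hy, rfl⟩ := Multiset.mem_map.mp hx
      -- `y` is a root of the Wronskian, hence special, hence outside the disc
      have hyS : y ∈ (p * q * (p - q)).roots := by
        have hpos : 0 < (wronskian p q).rootMultiplicity y :=
          (rootMultiplicity_pos h.wronskian_ne_zero).mpr ((mem_roots h.wronskian_ne_zero).mp hy)
        rw [h.rootMultiplicity_wronskian] at hpos
        have : 0 < (p * q * (p - q)).rootMultiplicity y := by omega
        exact (mem_roots h.prod_ne_zero).mpr ((rootMultiplicity_pos h.prod_ne_zero).mp this)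
      apply hnoS y hyS
      rw [← A.valuation_le_one_iff, map_mul, map_inv₀] at hxA
      have hvc0 : A.valuation c ≠ 0 := (Valuation.ne_zero_iff _).mpr hc0
      rwa [inv_mul_le_iff₀ (zero_lt_iff.mpr hvc0), mul_one] at hxA
    -- the derivative trick
    have hne' : (Multiset.card (intRoots A (P.comp L)) : ResidueField A) ≠
        Multiset.card (intRoots A (q.comp L)) := by
      rw [hnq, Nat.cast_zero]
      exact htame _ (by omega) hnPle
    have hP0' : P.comp L ≠ 0 := by
      rw [hL]; exact comp_C_add_C_mul_X_ne_zero hP0 _ hc0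
    have htrick := card_intRoots_wronskian A hP0' h'.right_ne_zero hne'
    rw [hnW, hnq] at htrick
    omega

end Unramified

/-! ### The optimal centre -/

section Centre

variable {K : Type*} [Field K] [IsAlgClosed K] [CharZero K] (A : ValuationSubring K)
variable {d : ℕ} {p q : K[X]}

omit [CharZero K] in
/-- **The optimal centre.**  For a Belyi pair `(p, q)` let `n = #intRoots A q` be the dominant index
of `q` and `a = p_n / q_n`.  Then `a` minimises the Gauss value of `p - a' q` over `a' ∈ K`, and the
reduction of `(p - a q)/q` at the Gauss point is NON-CONSTANT: `redPoly (p - a q) ≠ redPoly q`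
(otherwise subtracting the two primitive models would produce a better centre).  Note that `a` only
depends on the coefficients in the dominant degree. [folklore] -/
theorem IsBelyiPair.optimal_centre (h : IsBelyiPair d p q) {n : ℕ}
    (hn : n = Multiset.card (intRoots A q)) {a : K} (ha : a = p.coeff n / q.coeff n) :
    (∀ a' : K, gaussVal A (p - C a * q) ≤ gaussVal A (p - C a' * q)) ∧
      redPoly A (p - C a * q) ≠ redPoly A q := by
  have hq := h.right_ne_zero
  have hqn : A.valuation (q.coeff n) = gaussVal A q := by
    rw [hn]; exact valuation_coeff_card_intRoots A hq (IsAlgClosed.splits q)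
  have hqn0 : q.coeff n ≠ 0 := by
    intro h0
    rw [h0, map_zero] at hqn
    exact gaussVal_ne_zero A hq hqn.symm
  -- minimality
  have hmin : ∀ a' : K, gaussVal A (p - C a * q) ≤ gaussVal A (p - C a' * q) := by
    intro a'
    have hcoeff : (p - C a' * q).coeff n = q.coeff n * (a - a') := by
      rw [coeff_sub, coeff_C_mul, ha, mul_sub, mul_div_cancel₀ _ hqn0]; ring
    have h1 : gaussVal A q * A.valuation (a - a') ≤ gaussVal A (p - C a' * q) := by
      rw [← hqn, ← map_mul, ← hcoeff]
      exact valuation_coeff_le_gaussVal A _ n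
    have hdecomp : p - C a * q = (p - C a' * q) - C (a - a') * q := by
      rw [map_sub]; ring
    calc gaussVal A (p - C a * q)
        ≤ max (gaussVal A (p - C a' * q)) (gaussVal A (C (a - a') * q)) := by
          rw [hdecomp]; exact gaussVal_sub_le A _ _
      _ ≤ gaussVal A (p - C a' * q) := by
          refine max_le le_rfl ?_
          rw [gaussVal_C_mul, mul_comm]
          exact h1
  refine ⟨hmin, fun hred => ?_⟩
  -- non-constancy: compare the primitive models of `p - a q` and of `q`
  have hP0 : p - C a * q ≠ 0 := h.sub_C_mul_ne_zero a
  obtain ⟨c₁, hc₁, g₁, hg₁f, hg₁r⟩ := exists_model A hP0 (IsAlgClosed.splits _)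
  obtain ⟨c₂, hc₂, g₂, hg₂f, hg₂r⟩ := exists_model A hq (IsAlgClosed.splits _)
  have hdiff : (g₁ - g₂).map (residue A) = 0 := by
    rw [Polynomial.map_sub, hg₁r, hg₂r, hred, sub_self]
  have hlt : gaussVal A ((g₁ - g₂).map (algebraMap A K)) < 1 := (gaussVal_map_lt_one_iff A _).mpr hdiff
  have hmap : (g₁ - g₂).map (algebraMap A K) = C c₁ * (p - C (a + c₂ / c₁) * q) := by
    rw [Polynomial.map_sub, hg₁f, hg₂f, map_add]
    have hC : C c₁ * C (c₂ / c₁) = C c₂ := by rw [← C_mul, mul_div_cancel₀ _ hc₁]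
    calc C c₁ * (p - C a * q) - C c₂ * q
        = C c₁ * (p - C a * q) - C c₁ * C (c₂ / c₁) * q := by rw [hC]
      _ = C c₁ * (p - (C a + C (c₂ / c₁)) * q) := by ring
  rw [hmap, gaussVal_C_mul] at hlt
  have h1 : A.valuation c₁ * gaussVal A (p - C a * q) = 1 := valuation_mul_gaussVal_eq_one hg₁f hg₁r
  have := hmin (a + c₂ / c₁)
  have h2 : A.valuation c₁ * gaussVal A (p - C a * q) ≤
      A.valuation c₁ * gaussVal A (p - C (a + c₂ / c₁) * q) := mul_le_mul_right this _
  rw [h1] at h2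
  exact absurd (lt_of_le_of_lt h2 hlt) (lt_irrefl 1)

omit [CharZero K] in
/-- Existence form of the optimal centre. [folklore] -/
theorem IsBelyiPair.exists_optimal_centre (h : IsBelyiPair d p q) :
    ∃ a : K, (∀ a' : K, gaussVal A (p - C a * q) ≤ gaussVal A (p - C a' * q)) ∧
      redPoly A (p - C a * q) ≠ redPoly A q :=
  ⟨_, h.optimal_centre A rfl rfl⟩

end Centre

/-! ### Two-point Riemann–Hurwitz over the residue field -/

section TwoPoint

variable {k : Type*} [Field k]

/-- The multiplicity of a pole `x` of `P/Q` (a root of `Q` of multiplicity `e`, `P(x) ≠ 0`) as a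
root of the Wronskian `P Q' - P' Q` is exactly `e - 1`, provided `e ≠ 0` in `k`. [folklore] -/
theorem rootMultiplicity_wronskian_of_pole {P Q : k[X]} {x : k} (hQ : Q ≠ 0) (hPx : P.eval x ≠ 0)
    (hQx : Q.IsRoot x) (he : (Q.rootMultiplicity x : k) ≠ 0) :
    (wronskian P Q).rootMultiplicity x = Q.rootMultiplicity x - 1 := by
  set e := Q.rootMultiplicity x with he_def
  have he1 : 1 ≤ e := (rootMultiplicity_pos hQ).mpr hQx
  set g := Q /ₘ (X - C x) ^ e with hg
  have hQe : (X - C x) ^ e * g = Q := pow_mul_divByMonic_rootMultiplicity_eq Q x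
  have hgx : g.eval x ≠ 0 := by
    rw [hg, he_def]; exact eval_divByMonic_pow_rootMultiplicity_ne_zero x hQ
  -- `W = (X - x)^(e-1) · H` with `H(x) = e P(x) g(x) ≠ 0`
  set H : k[X] := C (e : k) * P * g + (X - C x) * (P * derivative g - derivative P * g) with hH
  have hW : wronskian P Q = (X - C x) ^ (e - 1) * H := by
    have hpow : (X - C x) ^ e = (X - C x) ^ (e - 1) * (X - C x) := by
      rw [← pow_succ, Nat.sub_add_cancel he1]
    rw [wronskian, ← hQe, derivative_mul, derivative_pow, derivative_X_sub_C, mul_one, hH, hpow,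
      map_natCast]
    ring
  have hHx : H.eval x ≠ 0 := by
    rw [hH]
    simp only [eval_add, eval_mul, eval_C, eval_sub, eval_X, sub_self, zero_mul, add_zero]
    exact mul_ne_zero (mul_ne_zero he hPx) hgx
  have hH0 : H ≠ 0 := fun h0 => hHx (by rw [h0, eval_zero])
  rw [hW, mul_comm, rootMultiplicity_mul_X_sub_C_pow hH0, rootMultiplicity_eq_zero_iff.mpr]
  · simp
  · intro hroot; exact absurd hroot hHx

/-- At an unramified finite point `x` that is neither a zero nor a pole (`R = P Q(x) - Q P(x)` is
non-zero with a simple root at `x`), the Wronskian does not vanish. [folklore] -/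
theorem eval_wronskian_ne_zero_of_unramified {P Q : k[X]} {x : k} (hQx : Q.eval x ≠ 0)
    (hR0 : P * C (Q.eval x) - Q * C (P.eval x) ≠ 0)
    (hunram : (P * C (Q.eval x) - Q * C (P.eval x)).rootMultiplicity x ≤ 1) :
    (wronskian P Q).eval x ≠ 0 := by
  set R : k[X] := P * C (Q.eval x) - Q * C (P.eval x) with hR
  have hRx : R.IsRoot x := by
    rw [IsRoot.def, hR]; simp [mul_comm]
  have hmult : R.rootMultiplicity x = 1 :=
    le_antisymm hunram ((rootMultiplicity_pos hR0).mpr hRx)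
  set g := R /ₘ (X - C x) ^ 1 with hg
  have hRg : (X - C x) ^ 1 * g = R := by
    rw [hg, ← hmult]; exact pow_mul_divByMonic_rootMultiplicity_eq R x
  have hgx : g.eval x ≠ 0 := by
    rw [hg, ← hmult]; exact eval_divByMonic_pow_rootMultiplicity_ne_zero x hR0
  -- `W(R, Q) = Q(x) W(P, Q)` and `W(R, Q)(x) = -g(x) Q(x)`
  have hWR : wronskian R Q = C (Q.eval x) * wronskian P Q := by
    rw [hR, mul_comm P, mul_comm Q, sub_eq_add_neg, wronskian_add_left, wronskian_C_mul_left,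
      wronskian_neg_left, wronskian_C_mul_left, wronskian_self_eq_zero, mul_zero, neg_zero, add_zero]
  have hev : (wronskian R Q).eval x = -(g.eval x * Q.eval x) := by
    rw [← hRg, pow_one, wronskian, derivative_mul, derivative_X_sub_C, one_mul]
    simp only [eval_sub, eval_mul, eval_add, eval_X, eval_C, sub_self, zero_mul]
    ring
  intro hW
  have : (wronskian R Q).eval x = 0 := by rw [hWR, eval_mul, eval_C, hW, mul_zero]
  rw [hev, neg_eq_zero] at this
  exact mul_ne_zero hgx hQx this

/-- The root multiplicity is invariant under negation. [folklore] -/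
theorem rootMultiplicity_neg' (f : k[X]) (x : k) : (-f).rootMultiplicity x = f.rootMultiplicity x := by
  rw [← count_roots, ← count_roots, roots_neg]

/-- **Two-point Riemann–Hurwitz over an algebraically closed field.**  Let `P, Q ∈ k[X]` be coprime
of DIFFERENT degrees, tame (`1, …, max (deg P) (deg Q)` non-zero in `k`), and suppose every point
`x` with `P(x) ≠ 0`, `Q(x) ≠ 0` is unramified for `P/Q` (`x` is a simple root of `P Q(x) - Q P(x)`).
Then `P` and `Q` have exactly one distinct root between them: `#Z(P) + #Z(Q) = 1`.  (The Wronskian has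
degree exactly `deg P + deg Q - 1`, all its roots are zeros or poles, with multiplicities `e - 1`.)
[folklore] -/
theorem card_roots_toFinset_add_eq_one [IsAlgClosed k] {P Q : k[X]} (hcop : IsCoprime P Q)
    (hdeg : P.natDegree ≠ Q.natDegree)
    (htame : ∀ m : ℕ, 0 < m → m ≤ max P.natDegree Q.natDegree → (m : k) ≠ 0)
    (hunram : ∀ x : k, P.eval x ≠ 0 → Q.eval x ≠ 0 →
      (P * C (Q.eval x) - Q * C (P.eval x)).rootMultiplicity x ≤ 1) :
    P.roots.toFinset.card + Q.roots.toFinset.card = 1 := by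
  -- non-vanishing
  have hunit : ∀ {a b : k[X]}, IsCoprime a b → a = 0 → b.natDegree = 0 := by
    intro a b hab ha
    subst ha
    exact natDegree_eq_zero_of_isUnit (isCoprime_zero_left.mp hab)
  have hP : P ≠ 0 := fun h0 => by
    have hQ0 := hunit hcop h0
    rw [h0, natDegree_zero] at hdeg
    exact hdeg hQ0.symm
  have hQ : Q ≠ 0 := fun h0 => by
    have hP0 := hunit hcop.symm h0
    rw [h0, natDegree_zero] at hdeg
    exact hdeg hP0
  set a := P.natDegree with ha
  set b := Q.natDegree with hb
  have hab1 : 1 ≤ a + b := by omega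
  -- the Wronskian: degree exactly `a + b - 1`
  set W := wronskian P Q with hWdef
  have hcoeff : W.coeff (a + b - 1) = ((b : k) - a) * P.leadingCoeff * Q.leadingCoeff :=
    coeff_wronskian_natDegree P Q hab1
  have hba : ((b : k) - a) ≠ 0 := by
    rcases lt_or_gt_of_ne hdeg with hlt | hlt
    · have := htame (b - a) (by omega) (by omega)
      rwa [Nat.cast_sub hlt.le] at this
    · have := htame (a - b) (by omega) (by omega)
      rw [Nat.cast_sub hlt.le] at this
      rwa [sub_ne_zero, ne_comm, ← sub_ne_zero]
  have hcoeff_ne : W.coeff (a + b - 1) ≠ 0 := by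
    rw [hcoeff]
    exact mul_ne_zero (mul_ne_zero hba (leadingCoeff_ne_zero.mpr hP)) (leadingCoeff_ne_zero.mpr hQ)
  have hW0 : W ≠ 0 := fun h0 => hcoeff_ne (by rw [h0, coeff_zero])
  have hWdeg : W.natDegree = a + b - 1 :=
    le_antisymm (natDegree_wronskian_le P Q) (le_natDegree_of_ne_zero hcoeff_ne)
  have hcardW : Multiset.card W.roots = a + b - 1 := by
    rw [← hWdeg]; exact ((IsAlgClosed.splits W).natDegree_eq_card_roots).symm
  -- roots of `W` are zeros or poles
  have hrootsW : W.roots.toFinset ⊆ P.roots.toFinset ∪ Q.roots.toFinset := by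
    intro x hx
    rw [Multiset.mem_toFinset, mem_roots hW0] at hx
    rw [Finset.mem_union, Multiset.mem_toFinset, Multiset.mem_toFinset, mem_roots hP, mem_roots hQ]
    by_contra hnot
    rw [not_or] at hnot
    have hPx : P.eval x ≠ 0 := hnot.1
    have hQx : Q.eval x ≠ 0 := hnot.2
    have hR0 : P * C (Q.eval x) - Q * C (P.eval x) ≠ 0 := by
      intro hR
      rw [sub_eq_zero] at hR
      have := congrArg natDegree hR
      rw [natDegree_mul_C hQx, natDegree_mul_C hPx] at this
      exact hdeg this
    exact eval_wronskian_ne_zero_of_unramified hQx hR0 (hunram x hPx hQx) hx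
  -- multiplicities at poles and zeros
  have hmultQ : ∀ x ∈ Q.roots.toFinset, W.rootMultiplicity x = Q.rootMultiplicity x - 1 := by
    intro x hx
    rw [Multiset.mem_toFinset, mem_roots hQ] at hx
    have hPx : P.eval x ≠ 0 := fun hPx =>
      (rootMultiplicity_pos hQ).mpr hx |>.ne'
        (rootMultiplicity_eq_zero_of_isCoprime_of_isRoot hcop hPx)
    refine rootMultiplicity_wronskian_of_pole hQ hPx hx (htame _ ((rootMultiplicity_pos hQ).mpr hx) ?_)
    exact (le_trans (by rw [← count_roots]; exact (Multiset.count_le_card _ _).trans (card_roots' Q))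
      (le_max_right _ _))
  have hmultP : ∀ x ∈ P.roots.toFinset, W.rootMultiplicity x = P.rootMultiplicity x - 1 := by
    intro x hx
    rw [Multiset.mem_toFinset, mem_roots hP] at hx
    have hQx : Q.eval x ≠ 0 := fun hQx =>
      (rootMultiplicity_pos hP).mpr hx |>.ne'
        (rootMultiplicity_eq_zero_of_isCoprime_of_isRoot hcop.symm hQx)
    rw [hWdef, ← wronskian_neg_eq, rootMultiplicity_neg']
    refine rootMultiplicity_wronskian_of_pole hP hQx hx (htame _ ((rootMultiplicity_pos hP).mpr hx) ?_)
    exact (le_trans (by rw [← count_roots]; exact (Multiset.count_le_card _ _).trans (card_roots' P))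
      (le_max_left _ _))
  -- count
  have hdisj : Disjoint P.roots.toFinset Q.roots.toFinset := by
    rw [Finset.disjoint_left]
    intro x hxP hxQ
    rw [Multiset.mem_toFinset, mem_roots hP] at hxP
    rw [Multiset.mem_toFinset, mem_roots hQ] at hxQ
    exact ((rootMultiplicity_pos hQ).mpr hxQ).ne'
      (rootMultiplicity_eq_zero_of_isCoprime_of_isRoot hcop hxP)
  have hsum : Multiset.card W.roots =
      ∑ x ∈ P.roots.toFinset, (P.rootMultiplicity x - 1) +
        ∑ x ∈ Q.roots.toFinset, (Q.rootMultiplicity x - 1) := by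
    rw [← Multiset.toFinset_sum_count_eq W.roots, Finset.sum_subset hrootsW, Finset.sum_union hdisj]
    · congr 1
      · exact Finset.sum_congr rfl fun x hx => by rw [count_roots, hmultP x hx]
      · exact Finset.sum_congr rfl fun x hx => by rw [count_roots, hmultQ x hx]
    · intro x _ hx
      rw [count_roots]
      exact rootMultiplicity_eq_zero fun hr => hx (Multiset.mem_toFinset.mpr ((mem_roots hW0).mpr hr))
  have hsP : ∑ x ∈ P.roots.toFinset, (P.rootMultiplicity x - 1) + P.roots.toFinset.card = a := by
    rw [Finset.card_eq_sum_ones, ← Finset.sum_add_distrib, ha,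
      ← sum_rootMultiplicity_eq_natDegree_of_splits (IsAlgClosed.splits P) subset_rfl]
    refine Finset.sum_congr rfl fun x hx => ?_
    have : 0 < P.rootMultiplicity x :=
      (rootMultiplicity_pos hP).mpr ((mem_roots hP).mp (Multiset.mem_toFinset.mp hx))
    omega
  have hsQ : ∑ x ∈ Q.roots.toFinset, (Q.rootMultiplicity x - 1) + Q.roots.toFinset.card = b := by
    rw [Finset.card_eq_sum_ones, ← Finset.sum_add_distrib, hb,
      ← sum_rootMultiplicity_eq_natDegree_of_splits (IsAlgClosed.splits Q) subset_rfl]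
    refine Finset.sum_congr rfl fun x hx => ?_
    have : 0 < Q.rootMultiplicity x :=
      (rootMultiplicity_pos hQ).mpr ((mem_roots hQ).mp (Multiset.mem_toFinset.mp hx))
    omega
  omega

end TwoPoint

/-! ### Vocabulary for the reduction theory of a Belyi pair at the Gauss point

(Used by the companion files `BelyiPairDepth`, `BelyiPairDescent`, `BelyiPairAscent`,
`BelyiPairNoDeep`, `BelyiPairCentral`.) -/

section Vocabulary

variable {K : Type*} [Field K] (A : ValuationSubring K)

/-- `r_Y(a) = min (v a) (v (a - 1))`: the valuation-radius below which a closed disc around `a`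
contains neither `0` nor `1` — i.e. its Gauss point is off the tripod `Y` spanned by `0, 1, ∞`
(whose points are exactly the Gauss points of the discs containing `0` or `1`). [folklore] -/
def rY (a : K) : A.ValueGroup := min (A.valuation a) (A.valuation (a - 1))

/-- `IsDeepPair A p q`: at the Gauss point, `p/q` is closer to some constant `a` than `r_Y(a)`:
`gaussVal (p - a q) < r_Y(a) · gaussVal q` ("the Gauss point maps off the tripod"). [folklore] -/
def IsDeepPair (p q : K[X]) : Prop := ∃ a : K, gaussVal A (p - C a * q) < rY A a * gaussVal A q

/-- The formula centre `p_n / q_n`, `n = #intRoots A q` the dominant index of `q`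
(see `IsBelyiPair.optimal_centre`). [folklore] -/
def centre (p q : K[X]) : K :=
  p.coeff (Multiset.card (intRoots A q)) / q.coeff (Multiset.card (intRoots A q))

/-- The number of special points of the pair in the closed unit disc. [folklore] -/
def nSpecIn (p q : K[X]) : ℕ := ((p * q * (p - q)).roots.toFinset.filter (· ∈ A)).card

/-- The number of special points of the pair outside the closed unit disc. [folklore] -/
def nSpecOut (p q : K[X]) : ℕ := ((p * q * (p - q)).roots.toFinset.filter (· ∉ A)).card

/-- The Gauss point is a *cluster point*: two integral special points have different residues.
[folklore] -/
def IsClusterPair (p q : K[X]) : Prop :=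
  ∃ s ∈ (p * q * (p - q)).roots, ∃ s' ∈ (p * q * (p - q)).roots, ∃ (hs : s ∈ A) (hs' : s' ∈ A),
    residue A ⟨s, hs⟩ ≠ residue A ⟨s', hs'⟩

end Vocabulary

end Literature.NumberTheory.DiophantineGeometry

end
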